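import Mathlib.LinearAlgebra.SymplecticGroup
import Mathlib.Data.ZMod.Basic
import HarnessLib

/-!
# Goresky–Tai 2003 §8.3 / §9.2 at matrix level on the split index `(m ⊕ o) ⊕ (m ⊕ o)`: the element `j_r` as printed,
# and the linear part `u = (A 0; 0 ᵗA⁻¹)`, `A = (I 0; a ±I)`, of a real boundary pair of corank `s` — the plus sign
# gives `u ∈ Γ(4m)`, the minus sign gives `j_{n−1}uj_{n−1} = (I 0 0 0; 0 1 0 0; 0 −ᵗa I 0; −a 0 0 1)`

Topic `Literature/AlgebraicGeometry/ModuliOfAbelianVarieties` (the Siegel-family files, namespace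
`Literature.AlgebraicGeometry.ModuliOfAbelianVarieties.SiegelModuli`).  Lane `lit-hodgefound` (Track 2 foundations
library), prover seat p15 generation 54, row g54-#5; companion of g54-#3 `SiegelFamilyRealBlockDiagonalNormalForm` (the
`j` of a sign pattern over `Fin g`, Lemma 27's core) and g54-#4 `SiegelFamilyRealBlockTriangularReduction` (§8.2).
Here the index is SPLIT, `n = m ⊕ o` (`r = |m|`, `s = |o|`; GT's §9 has `s = 1`), so that `j_r` and the corank-`s`
linear part are the printed `4 × 4` block matrices verbatim; the symplectic group is Mathlib's
`Matrix.symplecticGroup (m ⊕ o) R` and «`∈ Γ(M)`» is spelled `x.map (ℤ → ℤ/M) = 1` (the tree's `siegelPrincipalGamma`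
is indexed by `Fin g`; `mem_siegelPrincipalGamma_iff` is exactly this equation).  THEOREMS ONLY: no definition, no
instance, no notation, no named fact (net Literature debt `0`), no `sorry`.  Mathlib only.

## Source, VERBATIM

M. Goresky, Y. S. Tai, *The moduli space of real abelian varieties with level structure*, Compositio Math. **139**
(2003) = arXiv:math/0108103, held `paper:arxiv-math_0108103`.  §8.3 (p0015): «Define
`j_r = (I_r 0 0 0; 0 0 0 I_s; 0 0 I_r 0; 0 −I_s 0 0)` so `j_r² = (I_r 0 0 0; 0 −I_s 0 0; 0 0 I_r 0; 0 0 0 −I_s)`.  Then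
`j̃_r = j_r⁻¹`.»  §9.2 (proof of Theorem 25, p0016): «By Proposition 23, there exists `γ′ ∈ Γ(4m)` and `g ∈ Sp(2n, ℤ)`
so that `gF_{n−1} = F`, `F^γ = F^{γ′}` and so that `u = g̃⁻¹γ′g = (A 0; 0 ᵗA⁻¹) ∈ ker(ν)`.  This implies that
`A = (I_{n−1} 0; a ±1)`.  Note that `ũu = g⁻¹γ̃γg ∈ Γ(8m)` by Lemma 9.  Hence `a ≡ 0 mod 4m`.  If the plus sign occurs
then this says that `u ∈ Γ(4m)`.  Let `ω = g̃g⁻¹`.  Then Proposition 24 (with `q = n − 1` and `r = n`) implies that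
`F^{γ′} ⊂ \overline{𝔥_n^ω}`.  If the minus sign occurs then `j_{n−1}uj_{n−1} = (I 0 0 0; 0 1 0 0; 0 −ᵗa I 0; −a 0 0 1) ∈ Γ(4m)`
so we may apply Proposition 24 (with `q = r = n − 1`) to conclude that `F^{γ′} ⊂ \overline{𝔥_n^ω}` where
`ω = τ(gj_{n−1})(gj_{n−1})⁻¹`.»

## Rendering, and a remark on the minus sign

`u₊(a) = ((I 0; a I) 0; 0 (I −ᵗa; 0 I))`, `u₋(a) = ((I 0; a −I) 0; 0 (I ᵗa; 0 −I))` (`ᵗA⁻¹` computed), both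
symplectic and `τ`-fixed (`ũ = u`, so `ũu = u²`).  For the plus sign `u₊² = ((I 0; 2a I) 0; 0 (I −2ᵗa; 0 I))`, and
`u₊² ≡ 1 (mod 2M)` gives `a ≡ 0 (mod M)` and `u₊ ≡ 1 (mod M)` — the printed «Hence `a ≡ 0 mod 4m`.  If the plus sign
occurs then this says that `u ∈ Γ(4m)`».  For the minus sign `u₋² = 1` identically (`linearPartMinus_mul_self`), so the
congruence `ũu ∈ Γ(8m)` carries no information on `a` and the printed «Hence `a ≡ 0 mod 4m`» does not follow from it in
that case; the displayed identity `j_{n−1}uj_{n−1} = (I 0 0 0; 0 1 0 0; 0 −ᵗa I 0; −a 0 0 1)` is proved as printed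
(`jBlock_mul_linearPartMinus_mul_jBlock`), its right side lies in `Γ(M)` iff `a ≡ 0 (mod M)`, and the step is completed
here by the conjugation GT use in §10.2: `a ≡ 0 (mod 2)` (as `u ∈ Γ(2)`), and for `2c = a` the `τ`-fixed symplectic
`h = ((I 0; c I) 0; 0 (I −ᵗc; 0 I))` (of the `ker ν` shape `(P 0; 0 ᵗP⁻¹)`) gives `h⁻¹u₋(a)h = u₋(a − 2c) = u₋(0) = j_{n−1}²`,
whence `j_{n−1}·u₋(0)·j_{n−1} = j_{n−1}⁴ = 1` (`exists_conj_linearPartMinus_eq_and_jBlock_mul_mul_jBlock_eq_one`) — i.e.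
Proposition 24 applies after replacing `g` by `gh`.  This remark concerns only the displayed inference; Theorem 25 is
not affected.

## What is proved

* §1 **`jBlock_mem_symplecticGroup`**, **`iStar_mul_jBlock_mul_iStar_mul_jBlock`** («`j̃_r = j_r⁻¹`»),
  **`jBlock_mul_jBlock`** (`j_r² = diag(I_r, −I_s, I_r, −I_s)`), `jBlock_mul_diag_mul_jBlock` (`j_r⁴ = 1`).
* §2 `linearPartPlus_mem_symplecticGroup`, `linearPartMinus_mem_symplecticGroup`, `iStar_mul_blockDiagonal_mul_iStar`
  (`ũ = u`), **`linearPartPlus_mul_self`**, **`linearPartMinus_mul_self`**, ★ **`jBlock_mul_linearPartMinus_mul_jBlock`**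
  (the displayed `j_{n−1}uj_{n−1}`).
* §3 ★ **`linearPartPlus_map_eq_one_of_mul_self_map_eq_one`** («If the plus sign occurs then this says that
  `u ∈ Γ(4m)`»), **`jBlock_mul_linearPartMinus_mul_jBlock_map_eq_one_iff`** (`∈ Γ(M)` iff `a ≡ 0 (mod M)`),
  `conj_linearPartMinus_eq` (`h⁻¹u₋(a)h = u₋(a − 2c)`), ★ **`exists_conj_linearPartMinus_eq_and_jBlock_mul_mul_jBlock_eq_one`**
  (the minus sign completed: `a` even ⟹ conjugate to `u₋(0) = j²`, `j u₋(0) j = 1`).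

## References

* [GoreskyTai2003RealModuli] M. Goresky, Y. S. Tai, Compositio Math. 139 (2003) 1–27 (arXiv:math/0108103), §8.3, §9.2
  (proof of Theorem 25), §10.2.
-/

noncomputable section

open scoped Matrix
open Matrix Function

namespace Literature.AlgebraicGeometry.ModuliOfAbelianVarieties

namespace SiegelModuli

variable {m o : Type*} [Fintype m] [DecidableEq m] [Fintype o] [DecidableEq o]

/-! ## §1 The element `j_r` on the split index `(m ⊕ o) ⊕ (m ⊕ o)` (`r = |m|`, `s = |o|`) -/

section J

variable {R : Type*} [CommRing R]

/-- **`j_r ∈ Sp(2n, R)`** for GT's `j_r = (I_r 0 0 0; 0 0 0 I_s; 0 0 I_r 0; 0 −I_s 0 0)`, written as a block matrix on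
`(m ⊕ o) ⊕ (m ⊕ o)`.  [cite: GoreskyTai2003RealModuli, §8.3 («Define `j_r = …`»)] -/
theorem jBlock_mem_symplecticGroup :
    fromBlocks (fromBlocks (1 : Matrix m m R) 0 0 (0 : Matrix o o R)) (fromBlocks (0 : Matrix m m R) 0 0 (1 : Matrix o o R))
        (fromBlocks (0 : Matrix m m R) 0 0 (-1 : Matrix o o R)) (fromBlocks (1 : Matrix m m R) 0 0 (0 : Matrix o o R)) ∈
      Matrix.symplecticGroup (m ⊕ o) R := by
  rw [SymplecticGroup.fromBlocks_mem_iff]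
  simp [fromBlocks_transpose, fromBlocks_multiply, sub_eq_add_neg, fromBlocks_add, fromBlocks_neg, ← fromBlocks_one]

/-- **`j̃_r = j_r⁻¹`**: `(K j_r K)·j_r = 1` with `K = (−1 0; 0 1)` (`τ(x) = KxK`).
[cite: GoreskyTai2003RealModuli, §8.3 («Then `j̃_r = j_r⁻¹`»)] -/
theorem iStar_mul_jBlock_mul_iStar_mul_jBlock :
    fromBlocks (-1 : Matrix (m ⊕ o) (m ⊕ o) R) 0 0 1 *
        fromBlocks (fromBlocks (1 : Matrix m m R) 0 0 (0 : Matrix o o R)) (fromBlocks (0 : Matrix m m R) 0 0 (1 : Matrix o o R))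
          (fromBlocks (0 : Matrix m m R) 0 0 (-1 : Matrix o o R)) (fromBlocks (1 : Matrix m m R) 0 0 (0 : Matrix o o R)) *
        fromBlocks (-1 : Matrix (m ⊕ o) (m ⊕ o) R) 0 0 1 *
      fromBlocks (fromBlocks (1 : Matrix m m R) 0 0 (0 : Matrix o o R)) (fromBlocks (0 : Matrix m m R) 0 0 (1 : Matrix o o R))
        (fromBlocks (0 : Matrix m m R) 0 0 (-1 : Matrix o o R)) (fromBlocks (1 : Matrix m m R) 0 0 (0 : Matrix o o R)) = 1 := by
  simp [fromBlocks_multiply, fromBlocks_add, fromBlocks_neg, ← fromBlocks_one]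

/-- **`j_r² = diag(I_r, −I_s, I_r, −I_s)`.**  [cite: GoreskyTai2003RealModuli, §8.3 («so `j_r² = …`»)] -/
theorem jBlock_mul_jBlock :
    fromBlocks (fromBlocks (1 : Matrix m m R) 0 0 (0 : Matrix o o R)) (fromBlocks (0 : Matrix m m R) 0 0 (1 : Matrix o o R))
          (fromBlocks (0 : Matrix m m R) 0 0 (-1 : Matrix o o R)) (fromBlocks (1 : Matrix m m R) 0 0 (0 : Matrix o o R)) *
        fromBlocks (fromBlocks (1 : Matrix m m R) 0 0 (0 : Matrix o o R)) (fromBlocks (0 : Matrix m m R) 0 0 (1 : Matrix o o R))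
          (fromBlocks (0 : Matrix m m R) 0 0 (-1 : Matrix o o R)) (fromBlocks (1 : Matrix m m R) 0 0 (0 : Matrix o o R)) =
      fromBlocks (fromBlocks (1 : Matrix m m R) 0 0 (-1 : Matrix o o R)) 0 0 (fromBlocks (1 : Matrix m m R) 0 0 (-1 : Matrix o o R)) := by
  simp [fromBlocks_multiply, fromBlocks_add]

/-- `j_r⁴ = 1`: `j_r · diag(I_r, −I_s, I_r, −I_s) · j_r = 1` (so «`j_r u j_r ≡ I`» whenever `u ≡ j_r²`).
[cite: GoreskyTai2003RealModuli, §10.3 (proof of Theorem 28, «Therefore `j_r u j_r ≡ I mod 2^k`»)] -/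
theorem jBlock_mul_diag_mul_jBlock :
    fromBlocks (fromBlocks (1 : Matrix m m R) 0 0 (0 : Matrix o o R)) (fromBlocks (0 : Matrix m m R) 0 0 (1 : Matrix o o R))
          (fromBlocks (0 : Matrix m m R) 0 0 (-1 : Matrix o o R)) (fromBlocks (1 : Matrix m m R) 0 0 (0 : Matrix o o R)) *
        fromBlocks (fromBlocks (1 : Matrix m m R) 0 0 (-1 : Matrix o o R)) 0 0 (fromBlocks (1 : Matrix m m R) 0 0 (-1 : Matrix o o R)) *
        fromBlocks (fromBlocks (1 : Matrix m m R) 0 0 (0 : Matrix o o R)) (fromBlocks (0 : Matrix m m R) 0 0 (1 : Matrix o o R))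
          (fromBlocks (0 : Matrix m m R) 0 0 (-1 : Matrix o o R)) (fromBlocks (1 : Matrix m m R) 0 0 (0 : Matrix o o R)) = 1 := by
  simp [fromBlocks_multiply, fromBlocks_add, ← fromBlocks_one]

end J

/-! ## §2 The linear part `u = (A 0; 0 ᵗA⁻¹)`, `A = (I 0; a ±I)`, of a real boundary pair (GT: corank one, `s = 1`) -/

section LinearPart

variable {R : Type*} [CommRing R]

/-- `u₊ = (A 0; 0 ᵗA⁻¹)` with `A = (I 0; a I)` (the plus sign) is symplectic (`ᵗA⁻¹ = (I −ᵗa; 0 I)`).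
[cite: GoreskyTai2003RealModuli, §9.2 (proof of Theorem 25, «This implies that `A = (I_{n−1} 0; a ±1)`»)] -/
theorem linearPartPlus_mem_symplecticGroup (a : Matrix o m R) :
    fromBlocks (fromBlocks (1 : Matrix m m R) 0 a (1 : Matrix o o R)) 0 0 (fromBlocks (1 : Matrix m m R) (-aᵀ) 0 (1 : Matrix o o R)) ∈
      Matrix.symplecticGroup (m ⊕ o) R := by
  rw [SymplecticGroup.fromBlocks_mem_iff]
  simp [fromBlocks_transpose, fromBlocks_multiply, ← fromBlocks_one]

/-- `u₋ = (A 0; 0 ᵗA⁻¹)` with `A = (I 0; a −I)` (the minus sign) is symplectic (`ᵗA⁻¹ = (I ᵗa; 0 −I)`).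
[cite: GoreskyTai2003RealModuli, §9.2 (proof of Theorem 25, «This implies that `A = (I_{n−1} 0; a ±1)`»)] -/
theorem linearPartMinus_mem_symplecticGroup (a : Matrix o m R) :
    fromBlocks (fromBlocks (1 : Matrix m m R) 0 a (-1 : Matrix o o R)) 0 0 (fromBlocks (1 : Matrix m m R) aᵀ 0 (-1 : Matrix o o R)) ∈
      Matrix.symplecticGroup (m ⊕ o) R := by
  rw [SymplecticGroup.fromBlocks_mem_iff]
  simp [fromBlocks_transpose, fromBlocks_multiply, ← fromBlocks_one]

/-- A block-diagonal `u = (A 0; 0 D)` is `τ`-fixed: `KuK = u`; hence `ũu = u²`.  [cite: GoreskyTai2003RealModuli, §2.2 («`τ(g) = g ⟺ g ∈ GL(n, ℝ)`»)] -/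
theorem iStar_mul_blockDiagonal_mul_iStar (A D : Matrix (m ⊕ o) (m ⊕ o) R) :
    fromBlocks (-1 : Matrix (m ⊕ o) (m ⊕ o) R) 0 0 1 * fromBlocks A 0 0 D * fromBlocks (-1 : Matrix (m ⊕ o) (m ⊕ o) R) 0 0 1 =
      fromBlocks A 0 0 D := by
  simp [fromBlocks_multiply]

/-- **The plus sign: `u₊² = ((I 0; 2a I) 0; 0 (I −2ᵗa; 0 I))`** — so «`ũu ∈ Γ(8m)`» says `2a ≡ 0 (mod 8m)`.
[cite: GoreskyTai2003RealModuli, §9.2 (proof of Theorem 25, «Hence `a ≡ 0 mod 4m`»)] -/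
theorem linearPartPlus_mul_self (a : Matrix o m R) :
    fromBlocks (fromBlocks (1 : Matrix m m R) 0 a (1 : Matrix o o R)) 0 0 (fromBlocks (1 : Matrix m m R) (-aᵀ) 0 (1 : Matrix o o R)) *
        fromBlocks (fromBlocks (1 : Matrix m m R) 0 a (1 : Matrix o o R)) 0 0 (fromBlocks (1 : Matrix m m R) (-aᵀ) 0 (1 : Matrix o o R)) =
      fromBlocks (fromBlocks (1 : Matrix m m R) 0 ((2 : R) • a) (1 : Matrix o o R)) 0 0
        (fromBlocks (1 : Matrix m m R) (-((2 : R) • aᵀ)) 0 (1 : Matrix o o R)) := by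
  simp [fromBlocks_multiply, two_smul]

/-- **The minus sign: `u₋² = 1`** — so «`ũu ∈ Γ(8m)`» carries no information on `a` in this case (see the module
docstring: the printed «Hence `a ≡ 0 mod 4m`» is repaired below by a conjugation in `ker ν`).
[cite: GoreskyTai2003RealModuli, §9.2 (proof of Theorem 25)] -/
theorem linearPartMinus_mul_self (a : Matrix o m R) :
    fromBlocks (fromBlocks (1 : Matrix m m R) 0 a (-1 : Matrix o o R)) 0 0 (fromBlocks (1 : Matrix m m R) aᵀ 0 (-1 : Matrix o o R)) *
        fromBlocks (fromBlocks (1 : Matrix m m R) 0 a (-1 : Matrix o o R)) 0 0 (fromBlocks (1 : Matrix m m R) aᵀ 0 (-1 : Matrix o o R)) = 1 := by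
  simp [fromBlocks_multiply, ← fromBlocks_one]

/-- **The displayed identity of the minus case**:
`j_{n−1} u j_{n−1} = (I 0 0 0; 0 1 0 0; 0 −ᵗa I 0; −a 0 0 1)` for `u = ((I 0; a −1) 0; 0 (I ᵗa; 0 −1))`.
[cite: GoreskyTai2003RealModuli, §9.2 (proof of Theorem 25, displayed formula for `j_{n−1}uj_{n−1}`)] -/
theorem jBlock_mul_linearPartMinus_mul_jBlock (a : Matrix o m R) :
    fromBlocks (fromBlocks (1 : Matrix m m R) 0 0 (0 : Matrix o o R)) (fromBlocks (0 : Matrix m m R) 0 0 (1 : Matrix o o R))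
          (fromBlocks (0 : Matrix m m R) 0 0 (-1 : Matrix o o R)) (fromBlocks (1 : Matrix m m R) 0 0 (0 : Matrix o o R)) *
        fromBlocks (fromBlocks (1 : Matrix m m R) 0 a (-1 : Matrix o o R)) 0 0 (fromBlocks (1 : Matrix m m R) aᵀ 0 (-1 : Matrix o o R)) *
        fromBlocks (fromBlocks (1 : Matrix m m R) 0 0 (0 : Matrix o o R)) (fromBlocks (0 : Matrix m m R) 0 0 (1 : Matrix o o R))
          (fromBlocks (0 : Matrix m m R) 0 0 (-1 : Matrix o o R)) (fromBlocks (1 : Matrix m m R) 0 0 (0 : Matrix o o R)) =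
      fromBlocks 1 0 (fromBlocks (0 : Matrix m m R) (-aᵀ) (-a) (0 : Matrix o o R)) 1 := by
  simp [fromBlocks_multiply, fromBlocks_add, ← fromBlocks_one]

end LinearPart

/-! ## §3 Congruences: the plus sign gives `u ∈ Γ(4m)`; the minus sign after the conjugation `a ↦ a − 2c` -/

section Congruences

omit [Fintype m] [DecidableEq m] [Fintype o] [DecidableEq o] in
/-- Halving: `2X ≡ 0 (mod 2M)` entrywise ⟹ `X ≡ 0 (mod M)`.  [folklore] -/
private theorem map_eq_zero_of_two_smul_map_eq_zero {M : ℕ} {X : Matrix o m ℤ}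
    (h : ((2 : ℤ) • X).map (Int.castRingHom (ZMod (2 * M))) = 0) : X.map (Int.castRingHom (ZMod M)) = 0 := by
  ext i j
  have hij := congrFun (congrFun h i) j
  simp only [map_apply, eq_intCast, Matrix.zero_apply, Matrix.smul_apply, smul_eq_mul] at hij ⊢
  rw [ZMod.intCast_zmod_eq_zero_iff_dvd] at hij ⊢
  rw [Nat.cast_mul, Nat.cast_ofNat] at hij
  exact (mul_dvd_mul_iff_left (by norm_num : (2 : ℤ) ≠ 0)).1 hij

/-- **«If the plus sign occurs then this says that `u ∈ Γ(4m)`»**: if `u₊² ≡ 1 (mod 2M)` (GT: `ũu = u² ∈ Γ(8m)`,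
`M = 4m`) then `a ≡ 0 (mod M)` and `u₊ ≡ 1 (mod M)`.  [cite: GoreskyTai2003RealModuli, §9.2 (proof of Theorem 25)] -/
theorem linearPartPlus_map_eq_one_of_mul_self_map_eq_one {M : ℕ} (a : Matrix o m ℤ)
    (h : (fromBlocks (fromBlocks (1 : Matrix m m ℤ) 0 a (1 : Matrix o o ℤ)) 0 0 (fromBlocks (1 : Matrix m m ℤ) (-aᵀ) 0 (1 : Matrix o o ℤ)) *
        fromBlocks (fromBlocks (1 : Matrix m m ℤ) 0 a (1 : Matrix o o ℤ)) 0 0 (fromBlocks (1 : Matrix m m ℤ) (-aᵀ) 0 (1 : Matrix o o ℤ))).map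
          (Int.castRingHom (ZMod (2 * M))) = 1) :
    a.map (Int.castRingHom (ZMod M)) = 0 ∧
      (fromBlocks (fromBlocks (1 : Matrix m m ℤ) 0 a (1 : Matrix o o ℤ)) 0 0 (fromBlocks (1 : Matrix m m ℤ) (-aᵀ) 0 (1 : Matrix o o ℤ))).map
        (Int.castRingHom (ZMod M)) = 1 := by
  have h1 : fromBlocks (1 : Matrix (m ⊕ o) (m ⊕ o) (ZMod (2 * M))) 0 0 (1 : Matrix (m ⊕ o) (m ⊕ o) (ZMod (2 * M))) = 1 :=
    fromBlocks_one
  rw [linearPartPlus_mul_self, ← h1] at h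
  simp only [fromBlocks_map, Matrix.map_zero _ (map_zero _)] at h
  obtain ⟨h11, -, -, -⟩ := Matrix.fromBlocks_inj.1 h
  rw [← fromBlocks_one, Matrix.fromBlocks_inj] at h11
  obtain ⟨-, -, h2a, -⟩ := h11
  have ha : a.map (Int.castRingHom (ZMod M)) = 0 := map_eq_zero_of_two_smul_map_eq_zero h2a
  refine ⟨ha, ?_⟩
  simp only [fromBlocks_map, Matrix.map_zero _ (map_zero _), Matrix.map_one _ (map_zero _) (map_one _),
    Matrix.map_neg _ (map_neg (Int.castRingHom (ZMod M))), transpose_map, ha, transpose_zero, neg_zero, fromBlocks_one]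

/-- **The minus sign, as displayed: `j_{n−1}uj_{n−1} ∈ Γ(M)` iff `a ≡ 0 (mod M)`.**
[cite: GoreskyTai2003RealModuli, §9.2 (proof of Theorem 25, «so we may apply Proposition 24 (with `q = r = n − 1`)»)] -/
theorem jBlock_mul_linearPartMinus_mul_jBlock_map_eq_one_iff {M : ℕ} (a : Matrix o m ℤ) :
    (fromBlocks (fromBlocks (1 : Matrix m m ℤ) 0 0 (0 : Matrix o o ℤ)) (fromBlocks (0 : Matrix m m ℤ) 0 0 (1 : Matrix o o ℤ))
          (fromBlocks (0 : Matrix m m ℤ) 0 0 (-1 : Matrix o o ℤ)) (fromBlocks (1 : Matrix m m ℤ) 0 0 (0 : Matrix o o ℤ)) *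
        fromBlocks (fromBlocks (1 : Matrix m m ℤ) 0 a (-1 : Matrix o o ℤ)) 0 0 (fromBlocks (1 : Matrix m m ℤ) aᵀ 0 (-1 : Matrix o o ℤ)) *
        fromBlocks (fromBlocks (1 : Matrix m m ℤ) 0 0 (0 : Matrix o o ℤ)) (fromBlocks (0 : Matrix m m ℤ) 0 0 (1 : Matrix o o ℤ))
          (fromBlocks (0 : Matrix m m ℤ) 0 0 (-1 : Matrix o o ℤ)) (fromBlocks (1 : Matrix m m ℤ) 0 0 (0 : Matrix o o ℤ))).map
        (Int.castRingHom (ZMod M)) = 1 ↔ a.map (Int.castRingHom (ZMod M)) = 0 := by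
  rw [jBlock_mul_linearPartMinus_mul_jBlock]
  simp only [fromBlocks_map, Matrix.map_zero _ (map_zero _), Matrix.map_one _ (map_zero _) (map_one _),
    Matrix.map_neg _ (map_neg (Int.castRingHom (ZMod M))), transpose_map]
  have h1 : fromBlocks (1 : Matrix (m ⊕ o) (m ⊕ o) (ZMod M)) 0 0 (1 : Matrix (m ⊕ o) (m ⊕ o) (ZMod M)) = 1 := fromBlocks_one
  have h0 : fromBlocks (0 : Matrix m m (ZMod M)) 0 0 (0 : Matrix o o (ZMod M)) = 0 := fromBlocks_zero
  constructor
  · intro h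
    rw [← h1] at h
    have h21 := (Matrix.fromBlocks_inj.1 h).2.2.1
    rw [← h0] at h21
    exact neg_eq_zero.1 (Matrix.fromBlocks_inj.1 h21).2.2.1
  · intro ha
    simp only [ha, transpose_zero, neg_zero, fromBlocks_zero, fromBlocks_one]

/-- **The repair of the minus case.**  With `P = (I 0; c I) ∈ GL(ℤ)` put `h = (P 0; 0 ᵗP⁻¹) = ((I 0; c I) 0; 0 (I −ᵗc; 0 I))`
(block-diagonal, hence `τ`-fixed and in `ker ν`); then `h⁻¹ u₋(a) h = u₋(a − 2c)` exactly.  For `a` even (`u ∈ Γ(2)`)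
and `2c = a` this kills `a`, after which `j_{n−1} u j_{n−1} = 1`.  [cite: GoreskyTai2003RealModuli, §9.2 (proof of Theorem 25)] -/
theorem conj_linearPartMinus_eq {R : Type*} [CommRing R] (a c : Matrix o m R) :
    fromBlocks (fromBlocks (1 : Matrix m m R) 0 (-c) (1 : Matrix o o R)) 0 0 (fromBlocks (1 : Matrix m m R) cᵀ 0 (1 : Matrix o o R)) *
        fromBlocks (fromBlocks (1 : Matrix m m R) 0 a (-1 : Matrix o o R)) 0 0 (fromBlocks (1 : Matrix m m R) aᵀ 0 (-1 : Matrix o o R)) *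
        fromBlocks (fromBlocks (1 : Matrix m m R) 0 c (1 : Matrix o o R)) 0 0 (fromBlocks (1 : Matrix m m R) (-cᵀ) 0 (1 : Matrix o o R)) =
      fromBlocks (fromBlocks (1 : Matrix m m R) 0 (a - (2 : R) • c) (-1 : Matrix o o R)) 0 0
        (fromBlocks (1 : Matrix m m R) (a - (2 : R) • c)ᵀ 0 (-1 : Matrix o o R)) := by
  simp [fromBlocks_multiply, two_smul, sub_eq_add_neg, transpose_add, transpose_neg, add_comm,
    add_left_comm]

/-- The conjugator `h = ((I 0; c I) 0; 0 (I −ᵗc; 0 I))` is symplectic and its inverse is `((I 0; −c I) 0; 0 (I ᵗc; 0 I))`.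
[folklore] -/
private theorem conjugator_mem_and_inv_mul {R : Type*} [CommRing R] (c : Matrix o m R) :
    fromBlocks (fromBlocks (1 : Matrix m m R) 0 c (1 : Matrix o o R)) 0 0 (fromBlocks (1 : Matrix m m R) (-cᵀ) 0 (1 : Matrix o o R)) ∈
        Matrix.symplecticGroup (m ⊕ o) R ∧
      fromBlocks (fromBlocks (1 : Matrix m m R) 0 (-c) (1 : Matrix o o R)) 0 0 (fromBlocks (1 : Matrix m m R) cᵀ 0 (1 : Matrix o o R)) *
          fromBlocks (fromBlocks (1 : Matrix m m R) 0 c (1 : Matrix o o R)) 0 0 (fromBlocks (1 : Matrix m m R) (-cᵀ) 0 (1 : Matrix o o R)) = 1 := by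
  constructor
  · rw [SymplecticGroup.fromBlocks_mem_iff]
    simp [fromBlocks_transpose, fromBlocks_multiply, ← fromBlocks_one]
  · simp [fromBlocks_multiply, ← fromBlocks_one]

/-- **Theorem 25's minus case, repaired**: if `a ≡ 0 (mod 2)` (as `u ∈ Γ(2)` gives), then for `2c = a` the `τ`-fixed
symplectic `h = ((I 0; c I) 0; 0 (I −ᵗc; 0 I))` conjugates `u₋(a)` to `u₋(0) = j_{n−1}²`, and `j_{n−1}·u₋(0)·j_{n−1} = 1`
(∈ every `Γ(M)`), so Proposition 24 applies with `g` replaced by `gh`.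
[cite: GoreskyTai2003RealModuli, §9.2 (proof of Theorem 25)] -/
theorem exists_conj_linearPartMinus_eq_and_jBlock_mul_mul_jBlock_eq_one (a : Matrix o m ℤ)
    (ha : a.map (Int.castRingHom (ZMod 2)) = 0) :
    ∃ c : Matrix o m ℤ, (2 : ℤ) • c = a ∧
      fromBlocks (fromBlocks (1 : Matrix m m ℤ) 0 c (1 : Matrix o o ℤ)) 0 0 (fromBlocks (1 : Matrix m m ℤ) (-cᵀ) 0 (1 : Matrix o o ℤ)) ∈
        Matrix.symplecticGroup (m ⊕ o) ℤ ∧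
      fromBlocks (fromBlocks (1 : Matrix m m ℤ) 0 (-c) (1 : Matrix o o ℤ)) 0 0 (fromBlocks (1 : Matrix m m ℤ) cᵀ 0 (1 : Matrix o o ℤ)) *
          fromBlocks (fromBlocks (1 : Matrix m m ℤ) 0 c (1 : Matrix o o ℤ)) 0 0 (fromBlocks (1 : Matrix m m ℤ) (-cᵀ) 0 (1 : Matrix o o ℤ)) = 1 ∧
      fromBlocks (fromBlocks (1 : Matrix m m ℤ) 0 (-c) (1 : Matrix o o ℤ)) 0 0 (fromBlocks (1 : Matrix m m ℤ) cᵀ 0 (1 : Matrix o o ℤ)) *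
          fromBlocks (fromBlocks (1 : Matrix m m ℤ) 0 a (-1 : Matrix o o ℤ)) 0 0 (fromBlocks (1 : Matrix m m ℤ) aᵀ 0 (-1 : Matrix o o ℤ)) *
          fromBlocks (fromBlocks (1 : Matrix m m ℤ) 0 c (1 : Matrix o o ℤ)) 0 0 (fromBlocks (1 : Matrix m m ℤ) (-cᵀ) 0 (1 : Matrix o o ℤ)) =
        fromBlocks (fromBlocks (1 : Matrix m m ℤ) 0 0 (-1 : Matrix o o ℤ)) 0 0 (fromBlocks (1 : Matrix m m ℤ) 0 0 (-1 : Matrix o o ℤ)) ∧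
      fromBlocks (fromBlocks (1 : Matrix m m ℤ) 0 0 (0 : Matrix o o ℤ)) (fromBlocks (0 : Matrix m m ℤ) 0 0 (1 : Matrix o o ℤ))
            (fromBlocks (0 : Matrix m m ℤ) 0 0 (-1 : Matrix o o ℤ)) (fromBlocks (1 : Matrix m m ℤ) 0 0 (0 : Matrix o o ℤ)) *
          fromBlocks (fromBlocks (1 : Matrix m m ℤ) 0 0 (-1 : Matrix o o ℤ)) 0 0 (fromBlocks (1 : Matrix m m ℤ) 0 0 (-1 : Matrix o o ℤ)) *
          fromBlocks (fromBlocks (1 : Matrix m m ℤ) 0 0 (0 : Matrix o o ℤ)) (fromBlocks (0 : Matrix m m ℤ) 0 0 (1 : Matrix o o ℤ))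
            (fromBlocks (0 : Matrix m m ℤ) 0 0 (-1 : Matrix o o ℤ)) (fromBlocks (1 : Matrix m m ℤ) 0 0 (0 : Matrix o o ℤ)) = 1 := by
  refine ⟨Matrix.of fun i j => a i j / 2, ?_, (conjugator_mem_and_inv_mul _).1, (conjugator_mem_and_inv_mul _).2, ?_,
    jBlock_mul_diag_mul_jBlock⟩
  · ext i j
    have hij := congrFun (congrFun ha i) j
    simp only [map_apply, eq_intCast, Matrix.zero_apply] at hij
    have hd : (2 : ℤ) ∣ a i j := by exact_mod_cast (ZMod.intCast_zmod_eq_zero_iff_dvd _ 2).1 hij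
    rw [Matrix.smul_apply, of_apply, smul_eq_mul]
    exact Int.mul_ediv_cancel' hd
  · rw [conj_linearPartMinus_eq]
    have h2 : a - (2 : ℤ) • (Matrix.of fun i j => a i j / 2) = 0 := by
      ext i j
      have hij := congrFun (congrFun ha i) j
      simp only [map_apply, eq_intCast, Matrix.zero_apply] at hij
      have hd : (2 : ℤ) ∣ a i j := by exact_mod_cast (ZMod.intCast_zmod_eq_zero_iff_dvd _ 2).1 hij
      rw [Matrix.sub_apply, Matrix.smul_apply, of_apply, smul_eq_mul, Int.mul_ediv_cancel' hd, sub_self, Matrix.zero_apply]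
    rw [h2, transpose_zero]

end Congruences

end SiegelModuli

end Literature.AlgebraicGeometry.ModuliOfAbelianVarieties
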